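import Mathlib
import HarnessLib
import Summits.HubbardSuperconductivity.HubbardSuperconductivity.Theorems.KLProgrammeKLRegimeTwoVolumeTowerBaseTransferFrameDiff

/-!
# Route `KLProgramme` — crux K3, VL child `KLRegimeVolumeLimitV17F2` (stmt-HubbardSuperconductivity-20440), blueprint v5 M5 / W4 base data: THE WEIGHTED ROWS
# AND COLUMNS OF THE BASE TRANSFER FROM THOSE OF ITS TWO BLOCKS (conjuncts 1–2 of the base-transfer bundle `hdataT` of `…TowerBase` /
# `towerDataT_of_partsD`, reduced; seat hubbard-kl-k3c4-p1 g14; `--supports` 20440)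

`hdataT` asks for the `(1 + Λ_T·tnorm)`-weighted rows and columns of `klBaseTransfer (bL) M β μ K_L` to be `≤ cgW`.  The base transfer is block diagonal in the
copies: alive block `(ε • E(F_0[K]))·S_N`, source block `klSrcPlainBlock·S_N` (`…TowerBaseDefs`, `…TowerBaseTransferFrameDiff.klBaseTransfer_apply_*`).  Hence
its weighted rows / columns are those of the two blocks:

* **`sum_norm_klBaseTransfer_mul_wt_row_le`**, **`sum_norm_klBaseTransfer_mul_wt_col_le`** — from weighted rows / columns `≤ cgW` of the alive block and of the
  source block.

So conjuncts 1–2 of `hdataT` = TWO named analytic asks to the scale-0 lane: the `(1 + Λ_T·tnorm)`-weighted rows/columns of the scale-0 cross-grid overlap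
`ε • E(klAnisoFamily … K klE0 0)·hubbardGridSub` and of the plain source overlap `klSrcPlainBlock·hubbardGridSub` (`= ε • E(trivialMultiplier)·S_N` at slot `0`,
`klSrcPlainBlock_mul_apply`), uniformly in the volume.  Proofs only; no definition. [cite: BenfattoGiulianiMastropietro2006, §2.7 (2.70)–(2.71a)]
-/

noncomputable section

namespace Summit.HubbardSuperconductivity.HubbardSuperconductivity.Theorems.TwoVolumeSource

set_option linter.dupNamespace false -- summit = problem name (single-conjunct summit), D-0017

open Finset Literature.MathematicalPhysics.QuantumLattice GrassmannAlgebra Literature.Probability.LatticeModels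
open Summit.HubbardSuperconductivity.HubbardSuperconductivity.Theorems.KLProgrammeLegKernels
open Summit.HubbardSuperconductivity.HubbardSuperconductivity.Theorems.KLRegimeSplit
open Summit.HubbardSuperconductivity.HubbardSuperconductivity.Theorems.EngineV8
open Summit.HubbardSuperconductivity.HubbardSuperconductivity.Theorems.TwoVolumeDefect

variable {V M : ℕ} [NeZero V]

/-- **Weighted rows of the base transfer from the weighted rows of its two blocks.** [cite: BenfattoGiulianiMastropietro2006, §2.7 (2.71)] -/
theorem sum_norm_klBaseTransfer_mul_wt_row_le (β μ : ℝ) (K : TrigPolyC4v) (ΛT cgW : ℝ)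
    (hA : ∀ Y : SpaceTimeIdx V M × SectorLeg (sectorCount 0), ∑ y : GridLeg (GridPoint V (klGridN M)),
      ‖((((imagTimeWeight β M : ℝ) : ℂ) • sectorAnalysisMatrix V M β (klAnisoFamily V M β μ K klE0 0)) * hubbardGridSub V M β (klGridN M)) Y y‖ *
        (1 + ΛT * (Torus.tnorm (Y.1.2 - y.1.1.2) : ℝ)) ≤ cgW)
    (hB : ∀ Y : SpaceTimeIdx V M × SectorLeg (sectorCount 0), ∑ y : GridLeg (GridPoint V (klGridN M)),
      ‖(klSrcPlainBlock V M β * hubbardGridSub V M β (klGridN M)) Y y‖ * (1 + ΛT * (Torus.tnorm (Y.1.2 - y.1.1.2) : ℝ)) ≤ cgW)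
    (x : SrcLabel V M 0) :
    ∑ y : GridLeg (GridPoint V (klGridN M)) × Fin 2, ‖klBaseTransfer V M β μ K x y‖ * (1 + ΛT * (Torus.tnorm (x.1.1.2 - y.1.1.1.2) : ℝ)) ≤ cgW := by
  obtain ⟨Y, c⟩ := x
  revert c
  rw [Fin.forall_fin_two]
  refine ⟨?_, ?_⟩
  · rw [Fintype.sum_prod_type]
    simp_rw [Fin.sum_univ_two, klBaseTransfer_apply_zero_zero, klBaseTransfer_apply_zero_one, norm_zero, zero_mul, add_zero]
    exact hA Y
  · rw [Fintype.sum_prod_type]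
    simp_rw [Fin.sum_univ_two, klBaseTransfer_apply_one_zero, klBaseTransfer_apply_one_one, norm_zero, zero_mul, zero_add]
    exact hB Y

/-- **Weighted columns of the base transfer from the weighted columns of its two blocks.** [cite: BenfattoGiulianiMastropietro2006, §2.7 (2.71)] -/
theorem sum_norm_klBaseTransfer_mul_wt_col_le (β μ : ℝ) (K : TrigPolyC4v) (ΛT cgW : ℝ)
    (hA : ∀ y : GridLeg (GridPoint V (klGridN M)), ∑ Y : SpaceTimeIdx V M × SectorLeg (sectorCount 0),
      ‖((((imagTimeWeight β M : ℝ) : ℂ) • sectorAnalysisMatrix V M β (klAnisoFamily V M β μ K klE0 0)) * hubbardGridSub V M β (klGridN M)) Y y‖ *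
        (1 + ΛT * (Torus.tnorm (Y.1.2 - y.1.1.2) : ℝ)) ≤ cgW)
    (hB : ∀ y : GridLeg (GridPoint V (klGridN M)), ∑ Y : SpaceTimeIdx V M × SectorLeg (sectorCount 0),
      ‖(klSrcPlainBlock V M β * hubbardGridSub V M β (klGridN M)) Y y‖ * (1 + ΛT * (Torus.tnorm (Y.1.2 - y.1.1.2) : ℝ)) ≤ cgW)
    (y : GridLeg (GridPoint V (klGridN M)) × Fin 2) :
    ∑ x : SrcLabel V M 0, ‖klBaseTransfer V M β μ K x y‖ * (1 + ΛT * (Torus.tnorm (x.1.1.2 - y.1.1.1.2) : ℝ)) ≤ cgW := by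
  obtain ⟨yg, c⟩ := y
  revert c
  rw [Fin.forall_fin_two]
  refine ⟨?_, ?_⟩
  · rw [Fintype.sum_prod_type]
    simp_rw [Fin.sum_univ_two, klBaseTransfer_apply_zero_zero, klBaseTransfer_apply_one_zero, norm_zero, zero_mul, add_zero]
    exact hA yg
  · rw [Fintype.sum_prod_type]
    simp_rw [Fin.sum_univ_two, klBaseTransfer_apply_zero_one, klBaseTransfer_apply_one_one, norm_zero, zero_mul, zero_add]
    exact hB yg

end Summit.HubbardSuperconductivity.HubbardSuperconductivity.Theorems.TwoVolumeSource

end
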